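import Mathlib
import Summits.ResolutionOfSingularities.ResolutionOfSingularities.Theorems.WeightedInvariantLocalWeightedDropWildPurePowerFlagBasic
import Summits.ResolutionOfSingularities.ResolutionOfSingularities.Theorems.WeightedInvariantLocalWeightedDropWildPurePowerFlagEmbed
import Summits.ResolutionOfSingularities.ResolutionOfSingularities.Theorems.WeightedInvariantLocalWeightedDropWildPurePowerFlagAssembly
import Summits.ResolutionOfSingularities.ResolutionOfSingularities.Theorems.WeightedInvariantLocalWeightedDropWildMonicDescentNormal
import Summits.ResolutionOfSingularities.ResolutionOfSingularities.Theorems.WeightedInvariantLocalWeightedDropWildMonicShiftCoeff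
import Summits.ResolutionOfSingularities.ResolutionOfSingularities.Theorems.WeightedInvariantLocalWeightedDropWildMonicTerminalWon

/-!
# `WeightedInvariant.LocalWeightedDrop`, line `hasse-ridge-face-selection`, S3ρ: the ASSEMBLY (C9) of the descent datum S3ρD from two
# statements on an ABSTRACT flag-triple predicate `Φ` — attainment (D-0) and drop along normalised point blow-ups ((C6)–(C8))

Crux item stmt-ResolutionOfSingularities-8899 `LocalWeightedDrop` (route `ResolutionOfSingularities/WeightedInvariant`), engine of the
door `HypersurfaceCentreConstruction` stmt-ResolutionOfSingularities-19897.  [OURS · L1 W4.3, chain w43, res-type-083 (S3ρ first seat;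
ROADMAP item (C9) of `L/res-L1-w43-stub-7/S3RHOD-ROADMAP.md`).  Tuple version of stub-1's `PurePowerFlag.descent_of_statements`
(`…WildPurePowerFlagAssembly`), made GENERIC in the flag-triple predicate so that the D-0 seat's definitions (res-L1-w43-stub-3,
`L/res-L1-w43-stub-3/D0-SPEC.md`: flag family `(g, o, h)`, m-first maximisation, `IsFlagTriple`) instantiate it with zero coupling.
Perlega 2017/2020 (arXiv:2011.14443 Ch. 7 §7.5, Ch. 9 §9.1) is the MAP; every object is OURS; not a statement of any manuscript.]

OBJECTS.  `IsPos d A` (position: `ord A_j > d − j`); `Terminal d A` (the S3ρT predicate of `WildMonic.terminalWon`: monomial type /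
small-residual type, read on the tuple); `IsExit p d A` (the four exits of the lift `WildMonic.monic_won_of_descent₄`: terminal ∨ pure
`p^e`-form ∨ non-reduced factorisation ∨ zero tuple) and `Exit₃ p d A` («some legal free move `(θ, φ)` puts `A` in an exit» —
independent of the boundary and invariant under free moves by construction); for a predicate `Φ A E v` («`v = (d, n, s)` is a flag
triple of the position `A` with boundary letters `E`»): `measureΦ Φ p d A E := 0` if `Exit₃`, else `succ (⨆ Φ-triples, embed)`
(Perlega §7.5 «`i_X(a) = (o, c, d_F, n_F, s_F, …)` of a maximising flag», p0096), and the three SHAPES the other seats prove: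
`SwapShape` (letter-swap equivariance, by construction of the family), `AttainShape` = D-0 (Per17 Prop 7.4.10 + Lemma 7.4.11: at a
non-exit position the triples have a GREATEST element with finite `s`), `DropShape` = (C6)–(C8) (Per17 Prop 9.1.4 «for each valid
flag `G ∈ F(a')` there exists a valid flag `F ∈ F(a)` such that `inv(G) < inv(F)`», p0105, along the NORMALISED successor
`x^{d-j}·T_j = A_j(x, x(t+y))` of `monic_won_of_descent₄`, boundary rule `succE`, parent RAW).
THEOREMS.  `measureΦ_succ_lt` (the measure drops along every charged successor), `descent₄_of_shapes` (the S3ρD₄ datum: states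
`(A, E)`, `germ = A`, `μ = measureΦ`; cover by `E = ∅`; step = exit by the free move of `Exit₃`, else identity moves and the point
blow-up with stub-1's slot rule «slot `1` iff `c₀ = 0` or (`c₁ ≠ 0` and `E = {V(x₂)}`)», successor of the letter-swapped parent in
slot `1`), `wildMonicSurfaceReductionWon_of_shapes` (S3ρ `stub_wildMonicSurfaceReductionWon` VERBATIM from the three shapes, S3ρT
being PROVED).  AI-written; gate-accepted means sorry-free with standard axioms, not refereed.
-/

set_option linter.dupNamespace false -- mandated namespace of this single-conjunct summit

noncomputable section

namespace Summit.ResolutionOfSingularities.ResolutionOfSingularities.Theorems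

open Literature.AlgebraicGeometry.Resolution
open Literature.AlgebraicGeometry.Resolution.HauserPerlega2024
open Literature.AlgebraicGeometry.Resolution.CobordantGame

namespace WildMonic

open MvPowerSeries PurePowerFlag

variable {k : Type} [Field k]

/-! ### Positions, exits, the generic measure and the three shapes -/

/-- A POSITION of the S3ρ game: `ord A_j > d − j` for every slot (the monic form `y^d + Σ A_j y^j` has the `d`-fold plane `y^d` as
its tangent cone). -/
def IsPos (d : ℕ) (A : Fin d → MvPowerSeries (Fin 2) k) : Prop := ∀ j : Fin d, ((d - (j : ℕ) : ℕ) : ℕ∞) < (A j).order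

/-- THE TERMINAL PREDICATE of the S3ρ line (hypothesis of `WildMonic.terminalWon`, S3ρT): MONOMIAL TYPE (single vertex `v = (a/N, b/N)`
of the characteristic polyhedron, attained, not solvable when integral) OR SMALL-RESIDUAL TYPE (`x_i^{(d-j)m} ∣ A_j`, `m ≥ 1`, residual
orders in `𝔪`, one residual order `< d − j`).  [OURS; Perlega §7.3 monomial / small residual type read on the tuple.] -/
def Terminal (d : ℕ) (A : Fin d → MvPowerSeries (Fin 2) k) : Prop :=
  (∃ (N a b : ℕ), 0 < N ∧
    (∀ (j : Fin d) (β : Fin 2 →₀ ℕ), coeff β (A j) ≠ 0 → (d - (j : ℕ)) * a ≤ N * β 0 ∧ (d - (j : ℕ)) * b ≤ N * β 1) ∧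
    (∃ (j₀ : Fin d) (β : Fin 2 →₀ ℕ), N * β 0 = (d - (j₀ : ℕ)) * a ∧ N * β 1 = (d - (j₀ : ℕ)) * b ∧ coeff β (A j₀) ≠ 0) ∧
    (N ∣ a → N ∣ b → ∀ μ : k, ∃ j : Fin d,
      coeff (Finsupp.single 0 ((d - (j : ℕ)) * a / N) + Finsupp.single 1 ((d - (j : ℕ)) * b / N)) (A j) ≠
        (d.choose (j : ℕ) : k) * (-μ) ^ (d - (j : ℕ)))) ∨
  (∃ (i : Fin 2) (m : ℕ), 0 < m ∧
    (∀ j : Fin d, ∃ g : MvPowerSeries (Fin 2) k, constantCoeff g = 0 ∧ A j = X i ^ ((d - (j : ℕ)) * m) * g) ∧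
    (∃ (j₁ : Fin d) (g : MvPowerSeries (Fin 2) k), A j₁ = X i ^ ((d - (j₁ : ℕ)) * m) * g ∧
      g.order < ((d - (j₁ : ℕ) : ℕ) : ℕ∞)))

/-- THE FOUR EXITS of the lift `monic_won_of_descent₄` / `wildMonicSurfaceReductionWon_of_descent₄` on a tuple: terminal, pure `p^e`-th
power form (`d = p^e` and `A_j = 0` for `j ≠ 0`), NON-REDUCED (`y^d + Σ A_j y^j = U · ∏ Qᵢ^{mᵢ}` with `ord ∏ Qᵢ < d`), zero tuple. -/
def IsExit (p d : ℕ) (A : Fin d → MvPowerSeries (Fin 2) k) : Prop :=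
  (Terminal d A ∨
    ((∃ e : ℕ, d = p ^ e) ∧ ∀ j : Fin d, (j : ℕ) ≠ 0 → A j = 0) ∨
    (∃ (r : ℕ) (Q : Fin r → MvPowerSeries (Fin (2 + 1)) k) (mQ : Fin r → ℕ) (U : MvPowerSeries (Fin (2 + 1)) k),
      (∀ i, 1 ≤ mQ i) ∧ constantCoeff U ≠ 0 ∧
      ((X (Fin.last 2) : MvPowerSeries (Fin (2 + 1)) k) ^ d +
        ∑ j : Fin d, rename (Fin.succAboveEmb (Fin.last 2)) (A j) * X (Fin.last 2) ^ (j : ℕ) = U * ∏ i, Q i ^ mQ i) ∧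
      (∏ i, Q i).order < d)) ∨
  (∀ j : Fin d, A j = 0)

/-- `Exit₃`: SOME LEGAL FREE MOVE (plane change `θ` with `θ(0) = 0` and invertible linear part, then re-centring `y ↦ y + φ`,
`φ(0) = 0`) puts the tuple in a position that is an exit.  Independent of the boundary letters; «terminal case at `a`» of Perlega §7.5
(existence of apposite parameters of monomial / small residual type) widened by the game's other exits. -/
def Exit₃ (p d : ℕ) (A : Fin d → MvPowerSeries (Fin 2) k) : Prop :=
  ∃ (θ : Fin 2 → MvPowerSeries (Fin 2) k) (φ : MvPowerSeries (Fin 2) k),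
    (∀ i, constantCoeff (θ i) = 0) ∧ IsUnit (FormalCoordChange.linMat θ).det ∧ constantCoeff φ = 0 ∧
    IsPos d (shift d (fun j => subst θ (A j)) φ) ∧ IsExit p d (shift d (fun j => subst θ (A j)) φ)

open Classical in
/-- THE GENERIC MEASURE of a state `(A, E)` for a flag-triple predicate `Φ`: `0` at an `Exit₃` position, otherwise the successor of the
supremum of the ordinals `embed v = ω²·d + ω·n + s` of all triples `v` with `Φ A E v` (Perlega §7.5: the flag invariant of a
maximising flag, when the supremum is attained). -/
def measureΦ {d : ℕ} (Φ : (Fin d → MvPowerSeries (Fin 2) k) → Finset (Fin 2) → Triple → Prop) (p : ℕ)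
    (A : Fin d → MvPowerSeries (Fin 2) k) (E : Finset (Fin 2)) : Ordinal.{0} :=
  if Exit₃ p d A then 0 else Order.succ (⨆ v : {v : Triple // Φ A E v}, embed v.1)

/-- SWAP SHAPE (by construction of any flag family with both orientations): the triples of the letter-swapped tuple with the
letter-swapped boundary are the triples of the tuple. -/
def SwapShape {d : ℕ} (Φ : (Fin d → MvPowerSeries (Fin 2) k) → Finset (Fin 2) → Triple → Prop) : Prop :=
  ∀ (A : Fin d → MvPowerSeries (Fin 2) k) (E : Finset (Fin 2)) (v : Triple), Φ (fun j => swap (A j)) (swapE E) v ↔ Φ A E v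

/-- ATTAIN SHAPE = D-0 [Per17 Prop 7.4.10 + Lemma 7.4.11 in game form]: at a position that no free move puts in an exit, the `Φ`-triples
have a GREATEST element, whose `s`-component is finite. -/
def AttainShape {d : ℕ} (Φ : (Fin d → MvPowerSeries (Fin 2) k) → Finset (Fin 2) → Triple → Prop) (p : ℕ) : Prop :=
  ∀ (A : Fin d → MvPowerSeries (Fin 2) k) (E : Finset (Fin 2)), IsPos d A → ¬ Exit₃ p d A →
    ∃ v : Triple, Φ A E v ∧ (ofLex (ofLex v).2).2 ≠ ⊤ ∧ ∀ w, Φ A E w → w ≤ v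

/-- DROP SHAPE = (C6)–(C8) [Per17 Prop 9.1.4 in game form, along the NORMALISED point-blow-up successor of `monic_won_of_descent₄`]:
for a RAW parent position `A` (no cleanness assumed) with boundary letters `E` that no free move puts in an exit, a slope `t` obeying
the boundary rule «for `t ≠ 0`, `V(x₂)` is a boundary letter only together with `V(x₁)`», the successor tuple `T` with
`x^{d-j} · T_j = A_j(x, x(t + y))` (`PlaneGerm.dirChart t`; new exceptional letter `x = X 0`) and ANY re-centring `φ'` (`φ'(0) = 0`)
making it a position `shift d T φ'` that no free move puts in an exit: every `Φ`-triple of the successor with boundary `succE t E`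
is STRICTLY dominated by a `Φ`-triple of the parent. -/
def DropShape {d : ℕ} (Φ : (Fin d → MvPowerSeries (Fin 2) k) → Finset (Fin 2) → Triple → Prop) (p : ℕ) : Prop :=
  ∀ (A : Fin d → MvPowerSeries (Fin 2) k) (E : Finset (Fin 2)) (t : k) (T : Fin d → MvPowerSeries (Fin 2) k)
    (φ' : MvPowerSeries (Fin 2) k),
    IsPos d A → ¬ Exit₃ p d A → (t ≠ 0 → (1 : Fin 2) ∈ E → (0 : Fin 2) ∈ E) →
    (∀ j : Fin d, X 0 ^ (d - (j : ℕ)) * T j = subst (PlaneGerm.dirChart t) (A j)) →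
    constantCoeff φ' = 0 → IsPos d (shift d T φ') → ¬ Exit₃ p d (shift d T φ') →
    ∀ w, Φ (shift d T φ') (succE t E) w → ∃ v, Φ A E v ∧ w < v

/-! ### Basic facts: positions and exits under the letter swap -/

/-- Positions are preserved by the letter swap. -/
theorem isPos_swap {d : ℕ} {A : Fin d → MvPowerSeries (Fin 2) k} (hA : IsPos d A) : IsPos d (fun j => swap (A j)) :=
  fun j => by rw [order_swap]; exact hA j

/-- `Exit₃` of the letter-swapped tuple implies `Exit₃`: compose the exhibited plane change with the swap. -/
theorem exit₃_of_swap {p d : ℕ} {A : Fin d → MvPowerSeries (Fin 2) k} (h : Exit₃ p d (fun j => swap (A j))) : Exit₃ p d A := by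
  obtain ⟨θ, φ, hθ0, hθdet, hφ0, hpos, hex⟩ := h
  have hθs : HasSubst θ := hasSubst_of_constantCoeff_zero hθ0
  have hcomp : ∀ j : Fin d, subst θ (swap (A j)) = subst (fun i => θ (Equiv.swap (0 : Fin 2) 1 i)) (A j) := fun j => by
    rw [swap, rename_eq_subst, subst_comp_subst_apply (HasSubst.X_comp _) hθs]
    congr 1
    funext i
    rw [Function.comp_apply, subst_X hθs]
  have heq : (fun j => subst θ (swap (A j))) = fun j => subst (fun i => θ (Equiv.swap (0 : Fin 2) 1 i)) (A j) :=
    funext hcomp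
  refine ⟨fun i => θ (Equiv.swap (0 : Fin 2) 1 i), φ, fun i => hθ0 _, ?_, hφ0, heq ▸ hpos, heq ▸ hex⟩
  have hM : FormalCoordChange.linMat (fun i => θ (Equiv.swap (0 : Fin 2) 1 i)) =
      (FormalCoordChange.linMat θ).submatrix (Equiv.swap (0 : Fin 2) 1) id := by
    ext i j
    simp [FormalCoordChange.linMat]
  rw [hM, Matrix.det_permute]
  exact ((Equiv.Perm.sign _).isUnit.map (Int.castRingHom k)).mul hθdet

/-! ### Suprema of flag ordinals (generic) -/

omit [Field k] in
/-- At a state whose `Φ`-triples have a greatest element, the supremum of the ordinals is attained there. -/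
theorem iSup_embedΦ_eq {d : ℕ} {Φ : (Fin d → MvPowerSeries (Fin 2) k) → Finset (Fin 2) → Triple → Prop}
    {A : Fin d → MvPowerSeries (Fin 2) k} {E : Finset (Fin 2)} {v : Triple}
    (hv : Φ A E v) (hmax : ∀ w, Φ A E w → w ≤ v) :
    (⨆ w : {w : Triple // Φ A E w}, embed w.1) = embed v := by
  apply le_antisymm
  · exact ciSup_le' fun w => embed_le_embed (hmax w.1 w.2)
  · exact le_ciSup (Ordinal.bddAbove_of_small) (⟨v, hv⟩ : {w : Triple // Φ A E w})

omit [Field k] in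
/-- Every `Φ`-ordinal is below the supremum. -/
theorem embed_le_iSupΦ {d : ℕ} {Φ : (Fin d → MvPowerSeries (Fin 2) k) → Finset (Fin 2) → Triple → Prop}
    {A : Fin d → MvPowerSeries (Fin 2) k} {E : Finset (Fin 2)} {v : Triple} (hv : Φ A E v) :
    embed v ≤ ⨆ w : {w : Triple // Φ A E w}, embed w.1 :=
  le_ciSup (Ordinal.bddAbove_of_small) (⟨v, hv⟩ : {w : Triple // Φ A E w})

/-! ### The measure drops along every charged successor -/

/-- THE MEASURE DROPS, given the three shapes: parent state `(A, E)` read in orientation `o` (`orient o ∘ A`, boundary `orientE o E`),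
normalised successor `x^{d-j}·T'_j = (orient o A_j)(x, x(t+y))` under the boundary rule, new state `(shift d T' φ', succE t (orientE o E))`. -/
theorem measureΦ_succ_lt {p d : ℕ} {Φ : (Fin d → MvPowerSeries (Fin 2) k) → Finset (Fin 2) → Triple → Prop}
    (hswap : SwapShape Φ) (hattain : AttainShape Φ p) (hdrop : DropShape Φ p)
    (A : Fin d → MvPowerSeries (Fin 2) k) (E : Finset (Fin 2)) (o : Bool) (t : k) (T' : Fin d → MvPowerSeries (Fin 2) k)
    (φ' : MvPowerSeries (Fin 2) k) (hA : IsPos d A) (hex : ¬ Exit₃ p d A)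
    (hE : t ≠ 0 → (1 : Fin 2) ∈ orientE o E → (0 : Fin 2) ∈ orientE o E)
    (hT' : ∀ j : Fin d, X 0 ^ (d - (j : ℕ)) * T' j = subst (PlaneGerm.dirChart t) (orient o (A j)))
    (hφ'0 : constantCoeff φ' = 0) (hpos' : IsPos d (shift d T' φ')) :
    measureΦ Φ p (shift d T' φ') (succE t (orientE o E)) < measureΦ Φ p A E := by
  classical
  have hparent : measureΦ Φ p A E = Order.succ (⨆ v : {v : Triple // Φ A E v}, embed v.1) := by rw [measureΦ, if_neg hex]
  rw [hparent]
  by_cases hex' : Exit₃ p d (shift d T' φ')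
  · rw [measureΦ, if_pos hex']
    exact Order.lt_succ_of_le zero_le
  rw [measureΦ, if_neg hex', Order.succ_lt_succ_iff]
  -- attainment at the child, domination from the (oriented) parent, back to the parent by the swap shape
  obtain ⟨w, hw, hws, hwmax⟩ := hattain _ _ hpos' hex'
  rw [iSup_embedΦ_eq hw hwmax]
  have hAo : IsPos d (fun j => orient o (A j)) := by
    cases o
    · exact hA
    · exact isPos_swap hA
  have hexo : ¬ Exit₃ p d (fun j => orient o (A j)) := by
    cases o
    · exact hex
    · exact fun h => hex (exit₃_of_swap h)
  obtain ⟨v, hv, hwv⟩ := hdrop (fun j => orient o (A j)) (orientE o E) t T' φ' hAo hexo hE hT' hφ'0 hpos' hex' w hw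
  have hv' : Φ A E v := by
    cases o
    · exact hv
    · exact (hswap A E v).mp hv
  exact lt_of_lt_of_le (embed_lt_embed hwv hws) (embed_le_iSupΦ hv')

/-! ### The descent datum S3ρD₄ from the three shapes -/

/-- THE NORMALISED DESCENT DATUM S3ρD₄ FROM THE THREE SHAPES (any field `k`, any `p`, `d`): states `(A, E)`,
`germ = A`, `μ = measureΦ Φ p A E`; cover by `E = ∅`; step = the free move of `Exit₃` and exit, else identity moves and the point
blow-up with the slot rule «slot `1` iff `c₀ = 0` or (`c₁ ≠ 0` and `E = {V(x₂)}`)» — exactly the hypothesis `hdesc` of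
`wildMonicSurfaceReductionWon_of_descent₄` for the terminal predicate `Terminal`. -/
theorem descent₄_of_shapes (p : ℕ) (k : Type) [Field k] {d : ℕ}
    (Φ : (Fin d → MvPowerSeries (Fin 2) k) → Finset (Fin 2) → Triple → Prop)
    (hswap : SwapShape Φ) (hattain : AttainShape Φ p) (hdrop : DropShape Φ p) :
    ∃ (S : Type) (germ : S → Fin d → MvPowerSeries (Fin 2) k) (μ : S → Ordinal.{0}),
      (∀ A : Fin d → MvPowerSeries (Fin 2) k, (∀ j : Fin d, ((d - (j : ℕ) : ℕ) : ℕ∞) < (A j).order) →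
        ∃ s, germ s = A) ∧
      (∀ s : S, (∀ j : Fin d, ((d - (j : ℕ) : ℕ) : ℕ∞) < (germ s j).order) →
        ∃ (θ : Fin 2 → MvPowerSeries (Fin 2) k) (φ : MvPowerSeries (Fin 2) k),
          (∀ i, constantCoeff (θ i) = 0) ∧ IsUnit (FormalCoordChange.linMat θ).det ∧ constantCoeff φ = 0 ∧
          (∀ j : Fin d, ((d - (j : ℕ) : ℕ) : ℕ∞) < (shift d (fun j => subst θ (germ s j)) φ j).order) ∧
          ((Terminal d (shift d (fun j => subst θ (germ s j)) φ) ∨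
            ((∃ e : ℕ, d = p ^ e) ∧ ∀ j : Fin d, (j : ℕ) ≠ 0 → shift d (fun j => subst θ (germ s j)) φ j = 0) ∨
            (∃ (r : ℕ) (Q : Fin r → MvPowerSeries (Fin (2 + 1)) k) (mQ : Fin r → ℕ) (U : MvPowerSeries (Fin (2 + 1)) k),
              (∀ i, 1 ≤ mQ i) ∧ constantCoeff U ≠ 0 ∧
              ((X (Fin.last 2) : MvPowerSeries (Fin (2 + 1)) k) ^ d +
                ∑ j : Fin d, rename (Fin.succAboveEmb (Fin.last 2)) (shift d (fun j => subst θ (germ s j)) φ j) *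
                  X (Fin.last 2) ^ (j : ℕ) = U * ∏ i, Q i ^ mQ i) ∧
              (∏ i, Q i).order < d)) ∨
            (∀ j : Fin d, shift d (fun j => subst θ (germ s j)) φ j = 0) ∨
            ∀ (c : Fin 2 → k), (∃ i, c i ≠ 0) →
              (c 0 ≠ 0 ∧ ∀ T' : Fin d → MvPowerSeries (Fin 2) k,
                (∀ j : Fin d, X 0 ^ (d - (j : ℕ)) * T' j =
                  subst (PlaneGerm.dirChart (c 1 / c 0)) (shift d (fun j => subst θ (germ s j)) φ j)) →
                ∀ φ' : MvPowerSeries (Fin 2) k, constantCoeff φ' = 0 →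
                (∀ j : Fin d, ((d - (j : ℕ) : ℕ) : ℕ∞) < (shift d T' φ' j).order) →
                ∃ s' : S, germ s' = shift d T' φ' ∧ μ s' < μ s) ∨
              (c 1 ≠ 0 ∧ ∀ T' : Fin d → MvPowerSeries (Fin 2) k,
                (∀ j : Fin d, X 0 ^ (d - (j : ℕ)) * T' j =
                  subst (PlaneGerm.dirChart (c 0 / c 1))
                    (rename (Equiv.swap (0 : Fin 2) 1) (shift d (fun j => subst θ (germ s j)) φ j))) →
                ∀ φ' : MvPowerSeries (Fin 2) k, constantCoeff φ' = 0 →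
                (∀ j : Fin d, ((d - (j : ℕ) : ℕ) : ℕ∞) < (shift d T' φ' j).order) →
                ∃ s' : S, germ s' = shift d T' φ' ∧ μ s' < μ s))) := by
  classical
  refine ⟨(Fin d → MvPowerSeries (Fin 2) k) × Finset (Fin 2), Prod.fst, fun s => measureΦ Φ p s.1 s.2,
    fun A _ => ⟨(A, ∅), rfl⟩, ?_⟩
  rintro ⟨A, E⟩ hpos
  simp only at hpos ⊢
  by_cases hex : Exit₃ p d A
  · -- an exit up to a free move: play the move and exit
    obtain ⟨θ, φ, hθ0, hθdet, hφ0, hpos₁, hexit⟩ := hex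
    refine ⟨θ, φ, hθ0, hθdet, hφ0, hpos₁, ?_⟩
    rcases hexit with h3 | hz
    · exact Or.inl h3
    · exact Or.inr (Or.inl hz)
  · -- blow up the point: identity moves, then the slot rule
    have hXA : (fun j => subst (X : Fin 2 → MvPowerSeries (Fin 2) k) (A j)) = A := funext fun j => congrFun subst_self (A j)
    have hid : shift d (fun j => subst (X : Fin 2 → MvPowerSeries (Fin 2) k) (A j)) 0 = A := by rw [hXA, shift_zero]
    refine ⟨X, 0, fun i => constantCoeff_X i, by rw [linMat_X_det]; exact isUnit_one, map_zero _, by rw [hid]; exact hpos,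
      Or.inr (Or.inr fun c hc => ?_)⟩
    rw [hid]
    by_cases hslot : c 0 = 0 ∨ (c 1 ≠ 0 ∧ (1 : Fin 2) ∈ E ∧ (0 : Fin 2) ∉ E)
    · -- slot `1`, successor of the letter-swapped parent
      have hc1 : c 1 ≠ 0 := by
        rcases hslot with h0 | ⟨h1, -⟩
        · obtain ⟨i, hi⟩ := hc
          fin_cases i
          · exact absurd h0 hi
          · exact hi
        · exact h1
      refine Or.inr ⟨hc1, fun T' hT' φ' hφ'0 hpos' => ⟨(shift d T' φ', succE (c 0 / c 1) (orientE true E)), rfl, ?_⟩⟩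
      refine measureΦ_succ_lt hswap hattain hdrop A E true (c 0 / c 1) T' φ' hpos hex ?_ ?_ hφ'0 hpos'
      · intro ht h1
        rw [orientE_true, mem_swapE, Equiv.swap_apply_right] at h1
        rw [orientE_true, mem_swapE, Equiv.swap_apply_left]
        rcases hslot with h0 | ⟨-, -, h0E⟩
        · exact absurd (by rw [h0, zero_div]) ht
        · exact absurd h1 h0E
      · intro j; rw [orient_true]; exact hT' j
    · -- slot `0`
      push Not at hslot
      obtain ⟨hc0, hrest⟩ := hslot
      refine Or.inl ⟨hc0, fun T' hT' φ' hφ'0 hpos' => ⟨(shift d T' φ', succE (c 1 / c 0) (orientE false E)), rfl, ?_⟩⟩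
      refine measureΦ_succ_lt hswap hattain hdrop A E false (c 1 / c 0) T' φ' hpos hex ?_ ?_ hφ'0 hpos'
      · intro ht h1
        rw [orientE_false] at h1 ⊢
        have hc1' : c 1 ≠ 0 := fun h => ht (by rw [h, zero_div])
        exact hrest hc1' h1
      · intro j; rw [orient_false]; exact hT' j

/-! ### S3ρ verbatim from the three shapes -/

/-- S3ρ `stub_wildMonicSurfaceReductionWon` (skeleton v28/v29) VERBATIM FROM THE THREE SHAPES on any flag-triple predicate `Φ` (one per
field and degree): letter-swap equivariance, ATTAINMENT (D-0) and DROP ((C6)–(C8)) — S3ρT being the PROVED `WildMonic.terminalWon` and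
the lift being `wildMonicSurfaceReductionWon_of_descent₄`. -/
theorem wildMonicSurfaceReductionWon_of_shapes
    (Φ : ∀ (k : Type) [Field k] (d : ℕ), (Fin d → MvPowerSeries (Fin 2) k) → Finset (Fin 2) → Triple → Prop)
    (hswap : ∀ (p : ℕ), p.Prime → ∀ (k : Type) [Field k] [CharP k p] [IsAlgClosed k] (d : ℕ), p ∣ d → 2 < d →
      SwapShape (Φ k d))
    (hattain : ∀ (p : ℕ), p.Prime → ∀ (k : Type) [Field k] [CharP k p] [IsAlgClosed k] (d : ℕ), p ∣ d → 2 < d →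
      AttainShape (Φ k d) p)
    (hdrop : ∀ (p : ℕ), p.Prime → ∀ (k : Type) [Field k] [CharP k p] [IsAlgClosed k] (d : ℕ), p ∣ d → 2 < d →
      DropShape (Φ k d) p) :
    ∀ (p : ℕ), p.Prime → ∀ (k : Type) [Field k] [CharP k p] [IsAlgClosed k],
      (∀ m : ℕ, m < 3 → ∀ g : MvPowerSeries (Fin m) k,
        CobordantGame.IsSingular k g → CobordantGame.Won k m g) →
      ∀ (d : ℕ), p ∣ d → 2 < d →
      (∀ g : MvPowerSeries (Fin 3) k, CobordantGame.IsSingular k g → g.order < d →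
        CobordantGame.Won k 3 g) →
      (∀ g : MvPowerSeries (Fin 3) k, CobordantGame.IsSingular k g → g.order = d →
        (∃ c : Fin 3 → k, c ≠ 0 ∧ ∀ v : Fin 3 → k,
          CobordantChart.initEval (fun _ : Fin 3 => 1) (v + c) d g =
            CobordantChart.initEval (fun _ : Fin 3 => 1) v d g) →
        (∀ c₁ c₂ : Fin 3 → k,
          (∀ v : Fin 3 → k, CobordantChart.initEval (fun _ : Fin 3 => 1) (v + c₁) d g =
            CobordantChart.initEval (fun _ : Fin 3 => 1) v d g) →
          (∀ v : Fin 3 → k, CobordantChart.initEval (fun _ : Fin 3 => 1) (v + c₂) d g =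
            CobordantChart.initEval (fun _ : Fin 3 => 1) v d g) →
          ∃ α β : k, (α ≠ 0 ∨ β ≠ 0) ∧ α • c₁ + β • c₂ = 0) →
        CobordantGame.Won k 3 g) →
      ((∃ e : ℕ, d = p ^ e) → ∀ (A₀ : MvPowerSeries (Fin 2) k), (d : ℕ∞) < A₀.order →
        CobordantGame.Won k 3 (MvPowerSeries.X (Fin.last 2) ^ d +
          MvPowerSeries.rename (Fin.succAboveEmb (Fin.last 2)) A₀)) →
      ∀ A : Fin d → MvPowerSeries (Fin 2) k, (∀ j : Fin d, ((d - (j : ℕ) : ℕ) : ℕ∞) < (A j).order) →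
        CobordantGame.Won k 3 (MvPowerSeries.X (Fin.last 2) ^ d +
          ∑ j : Fin d, MvPowerSeries.rename (Fin.succAboveEmb (Fin.last 2)) (A j) * MvPowerSeries.X (Fin.last 2) ^ (j : ℕ)) :=
  wildMonicSurfaceReductionWon_of_descent₄ (fun _ _ d A => Terminal d A)
    (fun p hp k _ _ _ d hpd h2d hord haxis A hA hT => terminalWon p hp k d hpd h2d hord haxis A hA hT)
    (fun p hp k _ _ _ _ d hpd h2d _ _ =>
      descent₄_of_shapes p k (Φ k d) (hswap p hp k d hpd h2d) (hattain p hp k d hpd h2d) (hdrop p hp k d hpd h2d))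

/-! ### Drop shape with the parent's maximum in hand ((C6)–(C8) decoupled from D-0) -/

/-- DROP SHAPE WITH THE PARENT'S MAXIMUM IN HAND: as `DropShape`, but the parent's greatest `Φ`-triple `vmax` (with finite `s`) is GIVEN as a
hypothesis, and it then suffices to put every successor triple STRICTLY below `vmax` — Per17 Prop 9.1.4 case (1)'s escape «`s_F = ∞` ⇒ `F` is
not maximising ⇒ `inv(F) < inv(H)`» (p0105) is exactly `inv(F) < vmax`.  `dropShape_of_max`: with `AttainShape` this gives `DropShape`. -/
def DropShapeMax {d : ℕ} (Φ : (Fin d → MvPowerSeries (Fin 2) k) → Finset (Fin 2) → Triple → Prop) (p : ℕ) : Prop :=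
  ∀ (A : Fin d → MvPowerSeries (Fin 2) k) (E : Finset (Fin 2)) (t : k) (T : Fin d → MvPowerSeries (Fin 2) k)
    (φ' : MvPowerSeries (Fin 2) k) (vmax : Triple),
    IsPos d A → ¬ Exit₃ p d A → Φ A E vmax → (ofLex (ofLex vmax).2).2 ≠ ⊤ → (∀ u, Φ A E u → u ≤ vmax) →
    (t ≠ 0 → (1 : Fin 2) ∈ E → (0 : Fin 2) ∈ E) →
    (∀ j : Fin d, X 0 ^ (d - (j : ℕ)) * T j = subst (PlaneGerm.dirChart t) (A j)) →
    constantCoeff φ' = 0 → IsPos d (shift d T φ') → ¬ Exit₃ p d (shift d T φ') →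
    ∀ w, Φ (shift d T φ') (succE t E) w → w < vmax

/-- `AttainShape` + `DropShapeMax` ⇒ `DropShape`. -/
theorem dropShape_of_max {d p : ℕ} {Φ : (Fin d → MvPowerSeries (Fin 2) k) → Finset (Fin 2) → Triple → Prop}
    (hattain : AttainShape Φ p) (hmax : DropShapeMax Φ p) : DropShape Φ p := by
  intro A E t T φ' hA hex hE hT hφ' hpos' hex' w hw
  obtain ⟨vmax, hv, hs, hge⟩ := hattain A E hA hex
  exact ⟨vmax, hv, hmax A E t T φ' vmax hA hex hv hs hge hE hT hφ' hpos' hex' w hw⟩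

/-- Conversely `DropShape` ⇒ `DropShapeMax` (a strict dominator lies below the maximum). -/
theorem dropShapeMax_of_dropShape {d p : ℕ} {Φ : (Fin d → MvPowerSeries (Fin 2) k) → Finset (Fin 2) → Triple → Prop}
    (hdrop : DropShape Φ p) : DropShapeMax Φ p := by
  intro A E t T φ' vmax hA hex _ _ hge hE hT hφ' hpos' hex' w hw
  obtain ⟨v, hv, hwv⟩ := hdrop A E t T φ' hA hex hE hT hφ' hpos' hex' w hw
  exact lt_of_lt_of_le hwv (hge v hv)

end WildMonic

end Summit.ResolutionOfSingularities.ResolutionOfSingularities.Theorems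

end
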